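import Summits.NavierStokesRegularity.NavierStokesRegularity.Theorems.ScaledTopAlignmentBulkFatou
import Summits.NavierStokesRegularity.NavierStokesRegularity.Theorems.ScaledTopAlignmentTypeIZoomNonAlignedLimit
import HarnessLib

/-!
# Route `ScaledTopAlignment`: the bridge «W3′ (bulk scaled alignment) + NoTypeII ⇒ Clay (A)» for p3's
# staged one-item restate W3 → W3′ (support for stmt-NavierStokesRegularity-19901)

With GAP″ proved (`scaledTopAlignment_typeIZoomNonAlignedLimit_proof`) and the Fatou upgrade landed
(`dirSine_limit_eq_zero_of_scaledBulkAligned`, `ScaledTopAlignmentBulkFatou.lean`), p3's deciding theorem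
for the weakened door (`NsregP3.Bulk.closes_bulk`, `HOME/ns-regularity-ideate-p3/BulkAlignment.lean`)
becomes a tree theorem with the GAP″ hypothesis discharged:

* `navierStokesRegularity_of_aprioriScaledBulkAlignment_of_noTypeII` — W3′ (its definiens, verbatim from
  `NsregP3.Bulk.AprioriScaledBulkAlignment`) and the residual `NoTypeII` imply `NavierStokesRegularity`.

So a restated route {W3′, NoTypeII} closes by the one-line glue
`closes hW hII := navierStokesRegularity_of_aprioriScaledBulkAlignment_of_noTypeII hW hII`.
WHAT THIS IS NOT: not NS regularity — W3′ is an open a-priori estimate, NoTypeII the Type-II hard core.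
-/

noncomputable section

-- the summit and its single sub-problem share the name (CONVENTIONS §1), as in every Theorems file
set_option linter.dupNamespace false

open Filter Topology MeasureTheory Set

namespace Summit.NavierStokesRegularity.NavierStokesRegularity.Theorems

open Summit.NavierStokesRegularity.NavierStokesRegularity.Theses

/-! ### The bridge: W3′ + NoTypeII ⇒ Clay (A) -/

/-- **W3′ (a-priori scaled bulk top-set alignment) together with the residual NoTypeII implies the Clay
statement (A).** Hypothesis `hW` is the definiens, verbatim, of p3's staged door
`NsregP3.Bulk.AprioriScaledBulkAlignment` (W3′): for every classical Leray–Hopf solution from a rapidly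
decaying datum on `[0, T)`, every `λ ∈ (0,1)`, `R, ε, δ > 0`, there is `M > 0` such that at points
`|ω(t,x)| ≥ M` the `ε`-misaligned part of the relative top set in the scaled ball `|x−y| ≤ R√(ν/|ω(t,x)|)`
has measure `≤ δ (√(ν/|ω(t,x)|))³`. Proof = p3's `closes_bulk` with GAP″ discharged by
`scaledTopAlignment_typeIZoomNonAlignedLimit_proof`: a maximal solution is Type I (NoTypeII), GAP″ gives a
zoom limit `Ω` that is continuous, non-zero and not globally sign-parallel; the Fatou upgrade
(`dirSine_limit_eq_zero_of_scaledBulkAligned`) makes all non-zero values of `Ω` parallel — contradiction;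
so every such solution extends (`TypeILiouville.Assembly_holds` turns that into (A)). [cite: GigaMiura2011, Thm 1.1 (Commun. Math. Phys. 303 (2011) 289–300)] -/
theorem navierStokesRegularity_of_aprioriScaledBulkAlignment_of_noTypeII
    (hW : ∀ (ν T : ℝ), 0 < ν → 0 < T → ∀ (u : ℝ → EuclideanSpace ℝ (Fin 3) → EuclideanSpace ℝ (Fin 3))
      (p : ℝ → EuclideanSpace ℝ (Fin 3) → ℝ),
      Literature.Analysis.FluidPDE.IsClassicalNSSolutionOn (Set.Ico 0 T) ν 0 u p →
      Literature.Analysis.FluidPDE.IsLerayHopfOn T ν 0 (u 0) u →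
      Literature.Analysis.FluidPDE.HasRapidSpatialDecay (u 0) →
      ∀ lam : ℝ, 0 < lam → lam < 1 → ∀ R : ℝ, 0 < R → ∀ ε : ℝ, 0 < ε → ∀ δ : ℝ, 0 < δ →
      ∃ M : ℝ, 0 < M ∧ ∀ t ∈ Set.Ico 0 T, ∀ x : EuclideanSpace ℝ (Fin 3),
        M ≤ ‖Literature.Analysis.FluidPDE.curl (u t) x‖ →
        MeasureTheory.volume {y : EuclideanSpace ℝ (Fin 3) |
            lam * ‖Literature.Analysis.FluidPDE.curl (u t) x‖ ≤ ‖Literature.Analysis.FluidPDE.curl (u t) y‖ ∧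
            ‖x - y‖ ≤ R * Real.sqrt (ν / ‖Literature.Analysis.FluidPDE.curl (u t) x‖) ∧
            ε < Real.sqrt (1 - (inner ℝ (‖Literature.Analysis.FluidPDE.curl (u t) x‖⁻¹ •
              Literature.Analysis.FluidPDE.curl (u t) x)
              (‖Literature.Analysis.FluidPDE.curl (u t) y‖⁻¹ • Literature.Analysis.FluidPDE.curl (u t) y)) ^ 2)}
          ≤ ENNReal.ofReal (δ * Real.sqrt (ν / ‖Literature.Analysis.FluidPDE.curl (u t) x‖) ^ 3))
    (hII : ScaledTopAlignment.NoTypeII) :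
    _root_.NavierStokesRegularity := by
  -- adapted from NsregP3.Bulk.closes_bulk (planner p3 g1), GAP″ discharged
  have hZ : ScaledTopAlignment.TypeIZoomNonAlignedLimit := scaledTopAlignment_typeIZoomNonAlignedLimit_proof
  apply Summit.NavierStokesRegularity.NavierStokesRegularity.Theses.TypeILiouville.Assembly_holds
  intro ν T hν hT u p hcl hLH hdec
  by_contra hext
  have hmax : Literature.Analysis.FluidPDE.IsMaximalSmoothSolution ν 0 u p T := ⟨hcl, hext⟩
  have hI : Literature.Analysis.FluidPDE.IsTypeIBlowup u T := hII ν T hν hT u p hmax hLH hdec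
  have hbdd : ∀ T' < T, ∃ M : ℝ, ∀ s ∈ Set.Icc 0 T', ∀ x, ‖u s x‖ ≤ M := by
    intro T' hT'
    by_cases h : 0 < T'
    · exact liouvilleKillsTypeI_exists_bound_Icc hν hcl hLH hdec ⟨h, hT'⟩
    · obtain ⟨M, hM⟩ := liouvilleKillsTypeI_exists_bound_Icc hν hcl hLH hdec (T' := T / 2)
        ⟨by linarith, by linarith⟩
      push Not at h
      exact ⟨M, fun s hs x => hM s ⟨hs.1, by linarith [hs.2]⟩ x⟩
  obtain ⟨xc, t, lam, Ω, ht, hlam, hlam0, hΩ, hconv, hne0, hnal⟩ :=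
    hZ ν T hν hT u p hcl hLH hbdd hI hext
  have hfam := hW ν T hν hT u p hcl hLH hdec
  have hs : ∀ y₀ y : EuclideanSpace ℝ (Fin 3), Ω y₀ ≠ 0 → Ω y ≠ 0 →
      Real.sqrt (1 - (inner ℝ (‖Ω y₀‖⁻¹ • Ω y₀) (‖Ω y‖⁻¹ • Ω y)) ^ 2) = 0 := fun y₀ y hy₀ hy =>
    dirSine_limit_eq_zero_of_scaledBulkAligned hν (ω := fun s => Literature.Analysis.FluidPDE.curl (u s))
      hfam xc t ht lam hlam hlam0 Ω hΩ hconv y₀ y hy₀ hy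
  -- `Ω ≡ 0` or `Ω` is globally sign-parallel to `Ω y₀` — contradicting GAP″
  by_cases h0 : ∀ y, Ω y = 0
  · exact hne0 h0
  push Not at h0
  obtain ⟨y₀, hy₀⟩ := h0
  apply hnal
  refine ⟨Ω y₀, hy₀, ?_⟩
  intro y
  by_cases hy0 : Ω y = 0
  · simp [hy0]
  have hy : Ω y ≠ 0 := hy0
  set cc : ℝ := inner ℝ (‖Ω y‖⁻¹ • Ω y) (‖Ω y₀‖⁻¹ • Ω y₀) with hcc
  have hzero : Real.sqrt (1 - cc ^ 2) = 0 := hs y y₀ hy hy₀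
  have hc1 : 1 ≤ cc ^ 2 := by
    have := Real.sqrt_eq_zero'.mp hzero
    linarith
  have hny : ‖Ω y‖ ≠ 0 := norm_ne_zero_iff.mpr hy
  have hny₀ : ‖Ω y₀‖ ≠ 0 := norm_ne_zero_iff.mpr hy₀
  have hcval : cc = (‖Ω y‖⁻¹ * ‖Ω y₀‖⁻¹) * inner ℝ (Ω y) (Ω y₀) := by
    rw [hcc, real_inner_smul_left, real_inner_smul_right]; ring
  have hCS : (inner ℝ (Ω y) (Ω y₀)) ^ 2 ≤ ‖Ω y‖ ^ 2 * ‖Ω y₀‖ ^ 2 := by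
    have h1 := abs_real_inner_le_norm (Ω y) (Ω y₀)
    have h2 : 0 ≤ ‖Ω y‖ * ‖Ω y₀‖ := by positivity
    calc (inner ℝ (Ω y) (Ω y₀)) ^ 2 = |inner ℝ (Ω y) (Ω y₀)| ^ 2 := by rw [sq_abs]
      _ ≤ (‖Ω y‖ * ‖Ω y₀‖) ^ 2 := by
          nlinarith [h1, abs_nonneg (inner ℝ (Ω y) (Ω y₀))]
      _ = ‖Ω y‖ ^ 2 * ‖Ω y₀‖ ^ 2 := by ring
  have hge : ‖Ω y‖ ^ 2 * ‖Ω y₀‖ ^ 2 ≤ (inner ℝ (Ω y) (Ω y₀)) ^ 2 := by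
    rw [hcval] at hc1
    have hpos : 0 < ‖Ω y‖ ^ 2 * ‖Ω y₀‖ ^ 2 := by positivity
    have : 1 ≤ ((‖Ω y‖⁻¹ * ‖Ω y₀‖⁻¹) * inner ℝ (Ω y) (Ω y₀)) ^ 2 := hc1
    have hrew : ((‖Ω y‖⁻¹ * ‖Ω y₀‖⁻¹) * inner ℝ (Ω y) (Ω y₀)) ^ 2
        = (inner ℝ (Ω y) (Ω y₀)) ^ 2 / (‖Ω y‖ ^ 2 * ‖Ω y₀‖ ^ 2) := by
      field_simp
    rw [hrew, le_div_iff₀ hpos] at this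
    linarith
  exact le_antisymm hCS hge

end Summit.NavierStokesRegularity.NavierStokesRegularity.Theorems

end
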